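import Mathlib
import Literature.MathematicalPhysics.QuantumFieldTheory.Luscher2010.TrivializingMaps
import Literature.MathematicalPhysics.QuantumFieldTheory.Luscher2010.FlowActionSeries
import Literature.MathematicalPhysics.QuantumFieldTheory.ConstructiveQFTWave0Proofs
import Summits.Ventures.LatticeQCDFlow.TrivializingMaps.GaugeCovariance
import Summits.Ventures.LatticeQCDFlow.TrivializingMaps.BasisIndependence
import Summits.Ventures.LatticeQCDFlow.TrivializingMaps.NormalisedSeries
import HarnessLib

/-!
# Every smooth Lüscher series of a gauge-invariant action is gauge invariant on `SU(n)^E`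

HONEST FRAMING: exact (Metropolis-corrected) sampling algorithms for lattice gauge theory; figures of merit are
autocorrelation/cost numbers at stated couplings and volumes; no continuum-physics claim.

Lüscher, CMP 293 (2010) 899, §4.3 and §6: the orders `S̃^{(k)}` of the flow action are "sums of Wilson loops
and products of Wilson loops", hence gauge invariant, and the trivializing map "preserves the gauge symmetry".
The tree's `GaugeCovariance.isGaugeEquivariant_truncFlow` takes the gauge invariance of the `S̃^{(k)}` as a
HYPOTHESIS. This file proves it, for every smooth solution of the recursion (4.12)–(4.15) (`IsLuscherSeries`)
of any action `S` that is differentiable ambiently and gauge invariant on the field manifold — with no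
reference to loop expansions — from the UNIQUENESS of the Haar-normalised series (`NormalisedSeries`):

1. the ambient gauge action `ambGauge g : W ↦ (g(x) W(x,μ) g(x+μ̂)ᴴ)` intertwines the link curves, so
   `∂_{e,Y}(f ∘ G_g)(W) = ∂_{e, g(x)Yg(x)ᴴ} f (G_g W)` (`linkDeriv_comp_ambGauge`), and, summing over a basis
   and its `Ad_{g(x)}`-conjugate (`conjBasis`, `BasisIndependence.sum_suBasis_eq`),
   `Δ(f ∘ G_g) = (Δ f) ∘ G_g` (`linkLap_comp_ambGauge`) and `∑_a ∂^a S ∂^a(f ∘ G_g) = (∑_a ∂^a S ∂^a f) ∘ G_g`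
   on `SU(n)^E` for gauge-invariant `S` (`sum_linkDeriv_mul_comp_ambGauge`);
2. hence `(S̃^{(k)} ∘ G_g, Ċ^{(k)})` is again a smooth Lüscher series for `S` (`IsLuscherSeries.comp_ambGauge`),
   Haar-normalised if the original is (`IsHaarNormalised.comp_ambGauge`: `D[U]` is gauge invariant, tree
   `WilsonGauge.measurePreserving_gaugeTransform`);
3. by uniqueness the two agree on `SU(n)^E`: `S̃^{(k)}(U^g) = S̃^{(k)}(U)`
   (`IsLuscherSeries.isGaugeInvariant_of_isHaarNormalised`), and subtracting Haar means removes the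
   normalisation hypothesis (`IsLuscherSeries.isGaugeInvariant`);
4. corollary: the truncated Lüscher maps of such an action are gauge EQUIVARIANT
   (`isGaugeEquivariant_truncFlow_of_isLuscherSeries`, discharging the hypothesis of
   `isGaugeEquivariant_truncFlow`).

References: M. Lüscher, CMP 293 (2010) 899 [Luscher2010Trivializing, arXiv:0907.5491], §3.1, §4.2 eq. (4.4),
§4.3 eqs. (4.12)–(4.15), §6, App. A eqs. (A.1)–(A.5); E. Seiler, LNP 159 (1982) §1 (gauge invariance of the
a priori measure).
-/

namespace Summit.Ventures.LatticeQCDFlow.TrivializingMaps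

open MeasureTheory
open Literature.MathematicalPhysics.QuantumFieldTheory
open Literature.MathematicalPhysics.QuantumFieldTheory.Luscher2010
open Summit.Ventures.LatticeQCDFlow.Exactness (IsGaugeEquivariant)
open scoped Matrix Matrix.Norms.Frobenius ContDiff

noncomputable section

variable {d L n : ℕ}

/-! ## §1. The ambient gauge action and the link curves -/

/-- The **ambient gauge action** `(G_g W)(x,μ) = g(x) W(x,μ) g(x+μ̂)ᴴ` on `M_n(ℂ)^E`, extending
`gaugeTransform g` from `SU(n)^E`. [cite: Luscher2010Trivializing, §3.1] -/
def ambGauge (g : Site d L → Matrix.specialUnitaryGroup (Fin n) ℂ) (W : AmbConfig d L n) : AmbConfig d L n :=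
  fun e => (g e.1 : Matrix (Fin n) (Fin n) ℂ) * W e *
    ((g (e.1.shift e.2) : Matrix.specialUnitaryGroup (Fin n) ℂ) : Matrix (Fin n) (Fin n) ℂ)ᴴ

/-- `G_g ∘ ι = ι ∘ (·)^g`: the ambient action extends the gauge transformation of `SU(n)^E`. [folklore] -/
theorem ambGauge_coeConfig (g : Site d L → Matrix.specialUnitaryGroup (Fin n) ℂ)
    (U : GaugeConfig d L (Matrix.specialUnitaryGroup (Fin n) ℂ)) :
    ambGauge g (WilsonFlow.coeConfig U) = WilsonFlow.coeConfig (gaugeTransform g U) := by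
  funext e
  rw [coeConfig_gaugeTransform_apply]
  rfl

/-- The ambient gauge action is smooth (it is `ℝ`-linear). [folklore] -/
theorem contDiff_ambGauge [NeZero L] (g : Site d L → Matrix.specialUnitaryGroup (Fin n) ℂ) :
    ContDiff ℝ ∞ (ambGauge (d := d) (L := L) g) := by
  have h : ∀ e : Edge d L, ContDiff ℝ ∞ fun W : AmbConfig d L n => (g e.1 : Matrix (Fin n) (Fin n) ℂ) * W e *
      ((g (e.1.shift e.2) : Matrix.specialUnitaryGroup (Fin n) ℂ) : Matrix (Fin n) (Fin n) ℂ)ᴴ :=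
    fun e => (contDiff_const.mul (WilsonFlow.contDiff_eval e)).mul contDiff_const
  exact contDiff_pi.2 h

/-- `Ad_g` through the exponential: `g e^{sY} gᴴ = e^{s g Y gᴴ}` for `g ∈ SU(n)`. [folklore] -/
theorem mul_exp_smul_mul_conjTranspose (g : Matrix.specialUnitaryGroup (Fin n) ℂ)
    (Y : Matrix (Fin n) (Fin n) ℂ) (s : ℝ) :
    (g : Matrix (Fin n) (Fin n) ℂ) * NormedSpace.exp ((s : ℂ) • Y) * (g : Matrix (Fin n) (Fin n) ℂ)ᴴ =
      NormedSpace.exp ((s : ℂ) • ((g : Matrix (Fin n) (Fin n) ℂ) * Y * (g : Matrix (Fin n) (Fin n) ℂ)ᴴ)) := by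
  have h := exp_smul_conjTranspose_mul_mul g⁻¹ Y s
  rw [WilsonFlow.coe_inv_SU, Matrix.conjTranspose_conjTranspose] at h
  exact h.symm

/-- The ambient gauge action intertwines one-link left multiplications:
`G_g(W with W(e) ↦ M W(e)) = (G_g W) with (G_g W)(e) ↦ (g(x) M g(x)ᴴ)(G_g W)(e)`. [folklore] -/
theorem ambGauge_update_mul (g : Site d L → Matrix.specialUnitaryGroup (Fin n) ℂ) (W : AmbConfig d L n)
    (e : Edge d L) (M : Matrix (Fin n) (Fin n) ℂ) :
    ambGauge g (Function.update W e (M * W e)) =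
      Function.update (ambGauge g W) e
        (((g e.1 : Matrix (Fin n) (Fin n) ℂ) * M * (g e.1 : Matrix (Fin n) (Fin n) ℂ)ᴴ) * ambGauge g W e) := by
  funext e'
  by_cases h : e' = e
  · subst h
    simp only [ambGauge, Function.update_self, Matrix.mul_assoc]
    rw [← Matrix.mul_assoc ((g e'.1 : Matrix (Fin n) (Fin n) ℂ)ᴴ) (g e'.1 : Matrix (Fin n) (Fin n) ℂ),
      WilsonFlow.conjTranspose_mul_self_SU, Matrix.one_mul]
  · simp only [ambGauge, Function.update_of_ne h]

/-- **The gauge action transports link derivatives in the adjoint representation**: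
`∂_{e,Y}(f ∘ G_g)(W) = ∂_{e, g(x) Y g(x)ᴴ} f (G_g W)` — the two link curves are mapped onto each other by
`G_g` (no differentiability needed). [cite: Luscher2010Trivializing, §2.2 eq. (2.2), §3.1] -/
theorem linkDeriv_comp_ambGauge (f : AmbConfig d L n → ℝ) (g : Site d L → Matrix.specialUnitaryGroup (Fin n) ℂ)
    (e : Edge d L) (Y : Matrix (Fin n) (Fin n) ℂ) (W : AmbConfig d L n) :
    linkDeriv e Y (fun W' => f (ambGauge g W')) W =
      linkDeriv e ((g e.1 : Matrix (Fin n) (Fin n) ℂ) * Y * (g e.1 : Matrix (Fin n) (Fin n) ℂ)ᴴ) f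
        (ambGauge g W) := by
  unfold linkDeriv
  congr 1
  funext s
  show f (ambGauge g (Function.update W e (NormedSpace.exp ((s : ℂ) • Y) * W e))) = _
  rw [ambGauge_update_mul, mul_exp_smul_mul_conjTranspose]

/-- Iterated form: `∂_{e,X}∂_{e,Y}(f ∘ G_g)(W) = ∂_{e,Ad X}∂_{e,Ad Y} f (G_g W)`. [folklore] -/
theorem linkDeriv_linkDeriv_comp_ambGauge (f : AmbConfig d L n → ℝ)
    (g : Site d L → Matrix.specialUnitaryGroup (Fin n) ℂ) (e : Edge d L) (X Y : Matrix (Fin n) (Fin n) ℂ)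
    (W : AmbConfig d L n) :
    linkDeriv e X (linkDeriv e Y fun W' => f (ambGauge g W')) W =
      linkDeriv e ((g e.1 : Matrix (Fin n) (Fin n) ℂ) * X * (g e.1 : Matrix (Fin n) (Fin n) ℂ)ᴴ)
        (linkDeriv e ((g e.1 : Matrix (Fin n) (Fin n) ℂ) * Y * (g e.1 : Matrix (Fin n) (Fin n) ℂ)ᴴ) f)
        (ambGauge g W) := by
  have h1 : (linkDeriv e Y fun W' => f (ambGauge g W')) = fun W' =>
      linkDeriv e ((g e.1 : Matrix (Fin n) (Fin n) ℂ) * Y * (g e.1 : Matrix (Fin n) (Fin n) ℂ)ᴴ) f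
        (ambGauge g W') := funext fun W' => linkDeriv_comp_ambGauge f g e Y W'
  rw [h1, linkDeriv_comp_ambGauge]

/-! ## §2. The conjugated basis and the covariance of `Δ` and of the bilinear term -/

/-- The `Ad_h`-conjugate `(h T^a hᴴ)_a` of an orthonormal basis of `𝔰𝔲(n)` is again one (trace form
`Ad`-invariant, `Ad_h` bijective on `𝔰𝔲(n)`). [cite: Luscher2010Trivializing, App. A.1 eqs. (A.1)–(A.2)] -/
def conjBasis (B : SuBasis n) (h : Matrix.specialUnitaryGroup (Fin n) ℂ) : SuBasis n where
  ι := B.ι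
  T a := (h : Matrix (Fin n) (Fin n) ℂ) * B.T a * (h : Matrix (Fin n) (Fin n) ℂ)ᴴ
  mem a := mul_mul_conjTranspose_mem_suAlgebra h (B.mem a)
  orth a b := by
    have hm : (h : Matrix (Fin n) (Fin n) ℂ) * B.T a * (h : Matrix (Fin n) (Fin n) ℂ)ᴴ *
        ((h : Matrix (Fin n) (Fin n) ℂ) * B.T b * (h : Matrix (Fin n) (Fin n) ℂ)ᴴ) =
        (h : Matrix (Fin n) (Fin n) ℂ) * (B.T a * B.T b) * (h : Matrix (Fin n) (Fin n) ℂ)ᴴ := by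
      simp only [Matrix.mul_assoc]
      rw [← Matrix.mul_assoc ((h : Matrix (Fin n) (Fin n) ℂ)ᴴ) (h : Matrix (Fin n) (Fin n) ℂ),
        WilsonFlow.conjTranspose_mul_self_SU, Matrix.one_mul]
    rw [hm, Matrix.trace_mul_cycle, WilsonFlow.conjTranspose_mul_self_SU, Matrix.one_mul]
    exact B.orth a b
  span X hX := by
    obtain ⟨c, hc⟩ := B.span _ (conjTranspose_mul_mul_mem_suAlgebra h hX)
    refine ⟨c, ?_⟩
    have hX' : X = (h : Matrix (Fin n) (Fin n) ℂ) *
        ((h : Matrix (Fin n) (Fin n) ℂ)ᴴ * X * (h : Matrix (Fin n) (Fin n) ℂ)) * (h : Matrix (Fin n) (Fin n) ℂ)ᴴ := by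
      have e1 : (h : Matrix (Fin n) (Fin n) ℂ) * ((h : Matrix (Fin n) (Fin n) ℂ)ᴴ * X *
          (h : Matrix (Fin n) (Fin n) ℂ)) * (h : Matrix (Fin n) (Fin n) ℂ)ᴴ =
          ((h : Matrix (Fin n) (Fin n) ℂ) * (h : Matrix (Fin n) (Fin n) ℂ)ᴴ) * X *
            ((h : Matrix (Fin n) (Fin n) ℂ) * (h : Matrix (Fin n) (Fin n) ℂ)ᴴ) := by
        simp only [Matrix.mul_assoc]
      rw [e1, WilsonFlow.mul_conjTranspose_self_SU, Matrix.one_mul, Matrix.mul_one]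
    rw [hX', hc, Finset.mul_sum, Finset.sum_mul]
    refine Finset.sum_congr rfl fun a _ => ?_
    rw [Matrix.mul_smul, Matrix.smul_mul]

variable [NeZero L]

/-- **`Δ` commutes with the gauge action**: `Δ(f ∘ G_g)(W) = (Δ f)(G_g W)` for smooth `f` (per link, the
Casimir sum over the basis equals that over its `Ad_{g(x)}`-conjugate). [cite: Luscher2010Trivializing, §4.2 eq. (4.6), App. A.1] -/
theorem linkLap_comp_ambGauge (B : SuBasis n) {f : AmbConfig d L n → ℝ} (hf : ContDiff ℝ ∞ f)
    (g : Site d L → Matrix.specialUnitaryGroup (Fin n) ℂ) (W : AmbConfig d L n) :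
    linkLap B (fun W' => f (ambGauge g W')) W = linkLap B f (ambGauge g W) := by
  unfold linkLap
  congr 1
  refine Finset.sum_congr rfl fun e _ => ?_
  simp only [linkDeriv_linkDeriv_comp_ambGauge]
  refine sum_suBasis_eq (conjBasis B (g e.1)) B (fun X Y => linkDeriv e X (linkDeriv e Y f) (ambGauge g W))
    (fun c Y => ?_) (fun X c => ?_)
  · exact linkDeriv_sum_smul ((contDiff_linkDeriv hf e Y).differentiable (by simp) _) e c B.T
  · exact linkDeriv_linkDeriv_sum_smul (conjBasis B (g e.1)) hf e X c _

omit [NeZero L] in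
/-- For a gauge-INVARIANT `S`: `∂_{e,Y} S(ιU) = ∂_{e, g(x)Yg(x)ᴴ} S(ι U^g)` (`Y ∈ 𝔰𝔲(n)`).
[cite: Luscher2010Trivializing, §3.1] -/
theorem linkDeriv_conj_gaugeTransform_of_invariant {S : AmbConfig d L n → ℝ}
    (hSi : IsGaugeInvariant fun U : GaugeConfig d L (Matrix.specialUnitaryGroup (Fin n) ℂ) =>
      S (WilsonFlow.coeConfig U))
    (g : Site d L → Matrix.specialUnitaryGroup (Fin n) ℂ)
    (U : GaugeConfig d L (Matrix.specialUnitaryGroup (Fin n) ℂ)) (e : Edge d L)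
    {Y : Matrix (Fin n) (Fin n) ℂ} (hY : Y ∈ suAlgebra n) :
    linkDeriv e ((g e.1 : Matrix (Fin n) (Fin n) ℂ) * Y * (g e.1 : Matrix (Fin n) (Fin n) ℂ)ᴴ) S
        (WilsonFlow.coeConfig (gaugeTransform g U)) =
      linkDeriv e Y S (WilsonFlow.coeConfig U) := by
  rw [linkDeriv_gaugeTransform hSi g U e (mul_mul_conjTranspose_mem_suAlgebra (g e.1) hY)]
  congr 1
  have e1 : (g e.1 : Matrix (Fin n) (Fin n) ℂ)ᴴ * ((g e.1 : Matrix (Fin n) (Fin n) ℂ) * Y *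
      (g e.1 : Matrix (Fin n) (Fin n) ℂ)ᴴ) * (g e.1 : Matrix (Fin n) (Fin n) ℂ) =
      ((g e.1 : Matrix (Fin n) (Fin n) ℂ)ᴴ * (g e.1 : Matrix (Fin n) (Fin n) ℂ)) * Y *
        ((g e.1 : Matrix (Fin n) (Fin n) ℂ)ᴴ * (g e.1 : Matrix (Fin n) (Fin n) ℂ)) := by
    simp only [Matrix.mul_assoc]
  rw [e1, WilsonFlow.conjTranspose_mul_self_SU, Matrix.one_mul, Matrix.mul_one]

/-- **The bilinear term of the recursion is gauge covariant**: for gauge-invariant differentiable `S` and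
differentiable `f`, `∑_a ∂^a_e S(ιU) · ∂^a_e (f ∘ G_g)(ιU) = ∑_a ∂^a_e S(ιU^g) · ∂^a_e f(ιU^g)`.
[cite: Luscher2010Trivializing, §4.3 eq. (4.15), App. A.1] -/
theorem sum_linkDeriv_mul_comp_ambGauge (B : SuBasis n) {S f : AmbConfig d L n → ℝ}
    (hSi : IsGaugeInvariant fun U : GaugeConfig d L (Matrix.specialUnitaryGroup (Fin n) ℂ) =>
      S (WilsonFlow.coeConfig U))
    (hS : Differentiable ℝ S) (hf : Differentiable ℝ f) (g : Site d L → Matrix.specialUnitaryGroup (Fin n) ℂ)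
    (U : GaugeConfig d L (Matrix.specialUnitaryGroup (Fin n) ℂ)) (e : Edge d L) :
    ∑ a, linkDeriv e (B.T a) S (WilsonFlow.coeConfig U) *
        linkDeriv e (B.T a) (fun W' => f (ambGauge g W')) (WilsonFlow.coeConfig U) =
      ∑ a, linkDeriv e (B.T a) S (WilsonFlow.coeConfig (gaugeTransform g U)) *
        linkDeriv e (B.T a) f (WilsonFlow.coeConfig (gaugeTransform g U)) := by
  have h1 : ∀ a, linkDeriv e (B.T a) S (WilsonFlow.coeConfig U) *
      linkDeriv e (B.T a) (fun W' => f (ambGauge g W')) (WilsonFlow.coeConfig U) =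
      linkDeriv e ((conjBasis B (g e.1)).T a) S (WilsonFlow.coeConfig (gaugeTransform g U)) *
        linkDeriv e ((conjBasis B (g e.1)).T a) f (WilsonFlow.coeConfig (gaugeTransform g U)) := by
    intro a
    rw [linkDeriv_comp_ambGauge, ambGauge_coeConfig,
      ← linkDeriv_conj_gaugeTransform_of_invariant hSi g U e (B.mem a)]
    rfl
  simp only [h1]
  exact sum_linkDeriv_mul_suBasis_eq (conjBasis B (g e.1)) B (hS _) (hf _) e

/-! ## §3. Gauge transforms of Lüscher series are Lüscher series -/

/-- **`(S̃^{(k)} ∘ G_g, Ċ^{(k)})` solves the recursion again**, for `S` differentiable and gauge invariant on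
`SU(n)^E`. [cite: Luscher2010Trivializing, §4.3 eqs. (4.12)–(4.15)] -/
theorem IsLuscherSeries.comp_ambGauge {B : SuBasis n} {S : AmbConfig d L n → ℝ}
    {Sk : ℕ → AmbConfig d L n → ℝ} {c : ℕ → ℝ} (h : IsLuscherSeries B S Sk c)
    (hSi : IsGaugeInvariant fun U : GaugeConfig d L (Matrix.specialUnitaryGroup (Fin n) ℂ) =>
      S (WilsonFlow.coeConfig U))
    (hS : Differentiable ℝ S) (hsm : ∀ k, ContDiff ℝ ∞ (Sk k))
    (g : Site d L → Matrix.specialUnitaryGroup (Fin n) ℂ) :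
    IsLuscherSeries B S (fun k W => Sk k (ambGauge g W)) c := by
  have hSU : ∀ U : GaugeConfig d L (Matrix.specialUnitaryGroup (Fin n) ℂ),
      S (WilsonFlow.coeConfig (gaugeTransform g U)) = S (WilsonFlow.coeConfig U) := fun U => hSi g U
  refine ⟨fun U => ?_, fun k U => ?_⟩
  · show linkLap B (fun W => Sk 0 (ambGauge g W)) (WilsonFlow.coeConfig U) = _
    rw [linkLap_comp_ambGauge B (hsm 0) g, ambGauge_coeConfig, h.1, hSU]
  · show linkLap B (fun W => Sk (k + 1) (ambGauge g W)) (WilsonFlow.coeConfig U) =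
      -(∑ e : Edge d L, ∑ a : B.ι, linkDeriv e (B.T a) S (WilsonFlow.coeConfig U) *
          linkDeriv e (B.T a) (fun W => Sk k (ambGauge g W)) (WilsonFlow.coeConfig U)) + c (k + 1)
    rw [linkLap_comp_ambGauge B (hsm (k + 1)) g, ambGauge_coeConfig, h.2 k]
    congr 2
    exact Finset.sum_congr rfl fun e _ =>
      (sum_linkDeriv_mul_comp_ambGauge B hSi hS ((hsm k).differentiable (by simp)) g U e).symm

/-- **App. E's normalisation is gauge invariant**: `D[U]` is preserved by gauge transformations (tree
`WilsonGauge.measurePreserving_gaugeTransform`), so `S̃^{(k)} ∘ G_g` has zero Haar mean when `S̃^{(k)}` has.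
[cite: Luscher2010Trivializing, §2.1 eq. (2.1), App. E.2] -/
theorem IsHaarNormalised.comp_ambGauge {Sk : ℕ → AmbConfig d L n → ℝ} (hN : IsHaarNormalised Sk)
    (hsm : ∀ k, ContDiff ℝ ∞ (Sk k)) (g : Site d L → Matrix.specialUnitaryGroup (Fin n) ℂ) :
    IsHaarNormalised (fun k W => Sk k (ambGauge g W)) := by
  intro k
  have hmp : MeasurePreserving (gaugeTransform g)
      (trivialMeasure (Matrix.specialUnitaryGroup (Fin n) ℂ) d L)
      (trivialMeasure (Matrix.specialUnitaryGroup (Fin n) ℂ) d L) :=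
    WilsonGauge.measurePreserving_gaugeTransform g
  have hF : AEStronglyMeasurable
      (fun U : GaugeConfig d L (Matrix.specialUnitaryGroup (Fin n) ℂ) => Sk k (WilsonFlow.coeConfig U))
      (Measure.map (gaugeTransform g) (trivialMeasure (Matrix.specialUnitaryGroup (Fin n) ℂ) d L)) := by
    rw [hmp.map_eq]
    exact ((hsm k).continuous.comp WilsonFlow.continuous_coeConfig).aestronglyMeasurable
  show ∫ U, Sk k (ambGauge g (WilsonFlow.coeConfig U))
    ∂(trivialMeasure (Matrix.specialUnitaryGroup (Fin n) ℂ) d L) = 0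
  simp_rw [ambGauge_coeConfig]
  rw [← integral_map hmp.measurable.aemeasurable hF, hmp.map_eq]
  exact hN k

/-! ## §4. Gauge invariance of the series and equivariance of the truncated maps -/

/-- **A smooth Haar-normalised Lüscher series of a gauge-invariant action is gauge invariant on `SU(n)^E`**,
order by order: `S̃^{(k)}(ι U^g) = S̃^{(k)}(ι U)` (uniqueness of the normalised series,
`IsLuscherSeries.coeConfig_eq_of_isHaarNormalised`, applied to the series and its gauge transform).
[cite: Luscher2010Trivializing, §4.3, §6] -/
theorem IsLuscherSeries.isGaugeInvariant_of_isHaarNormalised {B : SuBasis n} {S : AmbConfig d L n → ℝ}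
    {Sk : ℕ → AmbConfig d L n → ℝ} {c : ℕ → ℝ} (h : IsLuscherSeries B S Sk c)
    (hSi : IsGaugeInvariant fun U : GaugeConfig d L (Matrix.specialUnitaryGroup (Fin n) ℂ) =>
      S (WilsonFlow.coeConfig U))
    (hS : Differentiable ℝ S) (hsm : ∀ k, ContDiff ℝ ∞ (Sk k)) (hN : IsHaarNormalised Sk) (k : ℕ) :
    IsGaugeInvariant fun U : GaugeConfig d L (Matrix.specialUnitaryGroup (Fin n) ℂ) =>
      Sk k (WilsonFlow.coeConfig U) := by
  intro g U
  show Sk k (WilsonFlow.coeConfig (gaugeTransform g U)) = Sk k (WilsonFlow.coeConfig U)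
  have huniq := IsLuscherSeries.coeConfig_eq_of_isHaarNormalised
    (IsLuscherSeries.comp_ambGauge h hSi hS hsm g) h
    (fun k => (hsm k).comp (contDiff_ambGauge g)) hsm (IsHaarNormalised.comp_ambGauge hN hsm g) hN k U
  rw [ambGauge_coeConfig] at huniq
  exact huniq

omit [NeZero L] in
/-- `∂` ignores additive constants. [folklore] -/
theorem linkDeriv_sub_const (e : Edge d L) (X : Matrix (Fin n) (Fin n) ℂ) (f : AmbConfig d L n → ℝ) (m : ℝ) :
    linkDeriv e X (fun W => f W - m) = linkDeriv e X f := by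
  funext W
  unfold linkDeriv
  simp only [deriv_sub_const]

/-- `Δ` ignores additive constants. [folklore] -/
theorem linkLap_sub_const (B : SuBasis n) (f : AmbConfig d L n → ℝ) (m : ℝ) (W : AmbConfig d L n) :
    linkLap B (fun W' => f W' - m) W = linkLap B f W := by
  unfold linkLap
  simp only [linkDeriv_sub_const]

/-- Subtracting the Haar means turns any smooth Lüscher series into a Haar-normalised one with the same
constants. [cite: Luscher2010Trivializing, §4.3, App. E.2] -/
theorem IsLuscherSeries.sub_haarMean {B : SuBasis n} {S : AmbConfig d L n → ℝ}
    {Sk : ℕ → AmbConfig d L n → ℝ} {c : ℕ → ℝ} (h : IsLuscherSeries B S Sk c)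
    (hsm : ∀ k, ContDiff ℝ ∞ (Sk k)) :
    IsLuscherSeries B S (fun k W => Sk k W - haarMean (Sk k)) c ∧
      IsHaarNormalised (fun k W => Sk k W - haarMean (Sk k)) ∧
      ∀ k, ContDiff ℝ ∞ (fun W => Sk k W - haarMean (Sk k)) := by
  refine ⟨⟨fun U => ?_, fun k U => ?_⟩, fun k => ?_, fun k => (hsm k).sub contDiff_const⟩
  · show linkLap B (fun W => Sk 0 W - haarMean (Sk 0)) (WilsonFlow.coeConfig U) = _
    rw [linkLap_sub_const, h.1 U]
  · show linkLap B (fun W => Sk (k + 1) W - haarMean (Sk (k + 1))) (WilsonFlow.coeConfig U) =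
      -(∑ e : Edge d L, ∑ a : B.ι, linkDeriv e (B.T a) S (WilsonFlow.coeConfig U) *
          linkDeriv e (B.T a) (fun W => Sk k W - haarMean (Sk k)) (WilsonFlow.coeConfig U)) + c (k + 1)
    rw [linkLap_sub_const, h.2 k U]
    simp only [linkDeriv_sub_const]
  · have hi : Integrable (fun U : GaugeConfig d L (Matrix.specialUnitaryGroup (Fin n) ℂ) =>
        Sk k (WilsonFlow.coeConfig U)) (trivialMeasure (Matrix.specialUnitaryGroup (Fin n) ℂ) d L) :=
      integrable_trivialMeasure_of_continuous ((hsm k).continuous.comp WilsonFlow.continuous_coeConfig)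
    show ∫ U, (Sk k (WilsonFlow.coeConfig U) - haarMean (Sk k))
      ∂(trivialMeasure (Matrix.specialUnitaryGroup (Fin n) ℂ) d L) = 0
    rw [integral_sub hi (integrable_const _), integral_const]
    simp [haarMean]

/-- **Every smooth Lüscher series of a gauge-invariant action is gauge invariant on `SU(n)^E`** (any
normalisation: the series differs from its Haar-normalised version by constants).
[cite: Luscher2010Trivializing, §4.3, §6] -/
theorem IsLuscherSeries.isGaugeInvariant {B : SuBasis n} {S : AmbConfig d L n → ℝ}
    {Sk : ℕ → AmbConfig d L n → ℝ} {c : ℕ → ℝ} (h : IsLuscherSeries B S Sk c)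
    (hSi : IsGaugeInvariant fun U : GaugeConfig d L (Matrix.specialUnitaryGroup (Fin n) ℂ) =>
      S (WilsonFlow.coeConfig U))
    (hS : Differentiable ℝ S) (hsm : ∀ k, ContDiff ℝ ∞ (Sk k)) (k : ℕ) :
    IsGaugeInvariant fun U : GaugeConfig d L (Matrix.specialUnitaryGroup (Fin n) ℂ) =>
      Sk k (WilsonFlow.coeConfig U) := by
  intro g U
  obtain ⟨hL, hN, hsm'⟩ := IsLuscherSeries.sub_haarMean h hsm
  have hinv := IsLuscherSeries.isGaugeInvariant_of_isHaarNormalised hL hSi hS hsm' hN k g U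
  show Sk k (WilsonFlow.coeConfig (gaugeTransform g U)) = Sk k (WilsonFlow.coeConfig U)
  have hinv' : Sk k (WilsonFlow.coeConfig (gaugeTransform g U)) - haarMean (Sk k) =
      Sk k (WilsonFlow.coeConfig U) - haarMean (Sk k) := hinv
  linarith

/-- **The truncated Lüscher maps of a gauge-invariant action are gauge EQUIVARIANT** — the hypothesis
"`S̃^{(k)}` gauge invariant" of `isGaugeEquivariant_truncFlow` discharged for every smooth solution of the
recursion: the time-`t` maps of the flow of `Z_t = -∂S̃^{[N]}_t` satisfy `Φ_t(V^g) = Φ_t(V)^g`, given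
uniqueness of its flow lines. [cite: Luscher2010Trivializing, §4.3, §4.5(c), §6] -/
theorem isGaugeEquivariant_truncFlow_of_isLuscherSeries (B : SuBasis n) {S : AmbConfig d L n → ℝ}
    {Sk : ℕ → AmbConfig d L n → ℝ} {c : ℕ → ℝ} (h : IsLuscherSeries B S Sk c)
    (hSi : IsGaugeInvariant fun U : GaugeConfig d L (Matrix.specialUnitaryGroup (Fin n) ℂ) =>
      S (WilsonFlow.coeConfig U))
    (hS : Differentiable ℝ S) (hSk : ∀ k, ContDiff ℝ ∞ (Sk k)) (N : ℕ)
    {Φ : ℝ → GaugeConfig d L (Matrix.specialUnitaryGroup (Fin n) ℂ) →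
      GaugeConfig d L (Matrix.specialUnitaryGroup (Fin n) ℂ)}
    (hΦ : IsFlowMap (fun t W => -linkGrad B (truncFlowAction Sk t N) W) Φ)
    (huniq : ∀ (U : ℝ → AmbConfig d L n) (V : GaugeConfig d L (Matrix.specialUnitaryGroup (Fin n) ℂ)),
      IsFlowLine (fun t W => -linkGrad B (truncFlowAction Sk t N) W) U → U 0 = WilsonFlow.coeConfig V →
        ∀ t, U t = WilsonFlow.coeConfig (Φ t V))
    (t : ℝ) : IsGaugeEquivariant (Φ t) :=
  isGaugeEquivariant_truncFlow B (fun k => IsLuscherSeries.isGaugeInvariant h hSi hS hSk k) hSk N hΦ huniq t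

end

end Summit.Ventures.LatticeQCDFlow.TrivializingMaps
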